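import Mathlib
import Literature.Analysis.PDE.GaussianBeam1DResidual

/-!
# First-order Gaussian beams for `u_tt − u_xx + μ² q(x) u = 0`: real part, regularity, size of
# the residual

Topic `Literature/Analysis/PDE` (namespace `Literature.Analysis.PDE`). Everything is proved; no
definitions. Companion of `GaussianBeam1DResidual.lean` (the exact residual identity
`F_tt − F_xx + μ²qF = e^{iμΦ}[μ²a𝓔 + iμ(T₁y + T₂y²) + a″]` of the complex beam
`F = a e^{iμΦ}`, `Φ = θ + ξy + ½Γy²`, `y = x − X(t)`):

* `iteratedDeriv_two_re`, `contDiff_beam`, `contDiff_beam_t`, `contDiff_beam_x` — the operator is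
  real and the beam is jointly `C²`, so the REAL beam `Re F` has the real part of that residual
  (`beam_re_residual`), in the `iteratedDeriv`-slice vocabulary of the tree's wave files;
* `norm_cexp_beamPhase` — `|e^{iμΦ}| = e^{−μ·Im Γ·y²/2}`: the beam is a Gaussian of width
  `(μ Im Γ)^{−1/2}` around the ray (`Im Γ > 0` by `Literature.Analysis.ODE.exists_beamPhase`);
* `gaussian_moment_bounds` — `μy²e^{−μβy²/2} ≤ 2/β`, `μ²y⁴e^{−μβy²/2} ≤ 16/β²` and, by
  `2|y| ≤ √μ y² + 1/√μ`, `μ|y|e^{−μβy²/2} ≤ √μ(2/β + 1)/2`, `μ²|y|³e^{−μβy²/2} ≤ √μ(16/β² + 2/β)/2`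
  (`μ ≥ 1`): every term of the residual is `O(√μ)` POINTWISE, uniformly in `y`
  (`norm_beam_residual_le`), whereas the beam itself has energy density `≍ μ²` on the width
  `μ^{−1/2}` — the `μ^{−1/2}`-accuracy of first-order beams (Ralston 1982, §2; Sbierski 2015,
  §3, second lemma).

## References

* J. Ralston, *Gaussian beams and the propagation of singularities*, MAA Stud. Math. 23 (1982)
  206–248, §2. Key `Ralston1982`.
* J. Sbierski, Anal. PDE 8 (2015) 1379–1420, §§2–3 (arXiv:1311.2477v2 §2.2–2.3; the remark on
  real-valued beams following Thm. 2.1). Key `Sbierski2015`.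
-/

noncomputable section

namespace Literature.Analysis.PDE

open Set Filter Topology Complex

section RealPart

variable {q : ℝ → ℝ} {X ξ θ : ℝ → ℝ} {Γ a : ℝ → ℂ} {μ ω₀ : ℝ}

/-- Second derivative of the real part of a `C²` complex curve. [folklore] -/
theorem iteratedDeriv_two_re {f : ℝ → ℂ} (hf : ContDiff ℝ 2 f) (t : ℝ) :
    iteratedDeriv 2 (fun s => (f s).re) t = (iteratedDeriv 2 f t).re := by
  have h1 : ∀ {g : ℝ → ℂ}, ContDiff ℝ 1 g → deriv (fun s => (g s).re) = fun s => (deriv g s).re := by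
    intro g hg
    funext s
    have hg' : HasDerivAt g (deriv g s) s := (hg.differentiable one_ne_zero s).hasDerivAt
    rw [show (fun s => (g s).re) = Complex.reCLM ∘ g from rfl]
    exact ((Complex.reCLM.hasFDerivAt.comp_hasDerivAt s hg').congr_deriv (by simp)).deriv
  rw [iteratedDeriv_succ, iteratedDeriv_one, iteratedDeriv_succ, iteratedDeriv_one,
    h1 (hf.of_le (by norm_num)), h1 hf.deriv']

/-- Joint `C²` regularity of the beam. [folklore] -/
theorem contDiff_beam (hX2 : ContDiff ℝ 2 X) (hξ2 : ContDiff ℝ 2 ξ) (hθ2 : ContDiff ℝ 2 θ)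
    (hΓ2 : ContDiff ℝ 2 Γ) (ha2 : ContDiff ℝ 2 a) :
    ContDiff ℝ 2 (Function.uncurry fun (t x : ℝ) => a t * cexp (I * μ * ((θ t : ℂ)
      + (ξ t : ℂ) * ((x : ℂ) - X t) + Γ t / 2 * ((x : ℂ) - X t) ^ 2))) := by
  have hofR : ContDiff ℝ 2 fun x : ℝ => (x : ℂ) := Complex.ofRealCLM.contDiff
  have hθ' : ContDiff ℝ 2 fun p : ℝ × ℝ => (θ p.1 : ℂ) := hofR.comp (hθ2.comp contDiff_fst)
  have hξ' : ContDiff ℝ 2 fun p : ℝ × ℝ => (ξ p.1 : ℂ) := hofR.comp (hξ2.comp contDiff_fst)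
  have hy' : ContDiff ℝ 2 fun p : ℝ × ℝ => (p.2 : ℂ) - X p.1 :=
    (hofR.comp contDiff_snd).sub (hofR.comp (hX2.comp contDiff_fst))
  have hΓ' : ContDiff ℝ 2 fun p : ℝ × ℝ => Γ p.1 := hΓ2.comp contDiff_fst
  have ha' : ContDiff ℝ 2 fun p : ℝ × ℝ => a p.1 := ha2.comp contDiff_fst
  exact ha'.mul (Complex.contDiff_exp.comp (contDiff_const.mul
    ((hθ'.add (hξ'.mul hy')).add ((hΓ'.div_const 2).mul (hy'.pow 2)))))

/-- `C²` regularity of the `t`-slices of the beam. [folklore] -/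
theorem contDiff_beam_t (hX2 : ContDiff ℝ 2 X) (hξ2 : ContDiff ℝ 2 ξ) (hθ2 : ContDiff ℝ 2 θ)
    (hΓ2 : ContDiff ℝ 2 Γ) (ha2 : ContDiff ℝ 2 a) (x : ℝ) :
    ContDiff ℝ 2 fun t => a t * cexp (I * μ * ((θ t : ℂ)
      + (ξ t : ℂ) * ((x : ℂ) - X t) + Γ t / 2 * ((x : ℂ) - X t) ^ 2)) :=
  (contDiff_beam (μ := μ) hX2 hξ2 hθ2 hΓ2 ha2).comp (contDiff_id.prodMk contDiff_const)

/-- `C²` regularity of the `x`-slices of the beam. [folklore] -/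
theorem contDiff_beam_x (hX2 : ContDiff ℝ 2 X) (hξ2 : ContDiff ℝ 2 ξ) (hθ2 : ContDiff ℝ 2 θ)
    (hΓ2 : ContDiff ℝ 2 Γ) (ha2 : ContDiff ℝ 2 a) (t : ℝ) :
    ContDiff ℝ 2 fun x : ℝ => a t * cexp (I * μ * ((θ t : ℂ)
      + (ξ t : ℂ) * ((x : ℂ) - X t) + Γ t / 2 * ((x : ℂ) - X t) ^ 2)) :=
  (contDiff_beam (μ := μ) hX2 hξ2 hθ2 hΓ2 ha2).comp (contDiff_const.prodMk contDiff_id)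

/-- **Exact residual of the REAL beam `Re F`** (the operator is real, so it is the real part of
`beam_residual`). [cite: Ralston1982, §2; Sbierski2015, §2 (remark on real beams)] -/
theorem beam_re_residual (hω₀ : ω₀ ≠ 0)
    (hX2 : ContDiff ℝ 2 X) (hξ2 : ContDiff ℝ 2 ξ) (hθ2 : ContDiff ℝ 2 θ) (hΓ2 : ContDiff ℝ 2 Γ)
    (ha2 : ContDiff ℝ 2 a)
    (hX : ∀ t, deriv X t = ξ t / ω₀) (hξ : ∀ t, deriv ξ t = -(deriv q (X t)) / (2 * ω₀))
    (hcons : ∀ t, ξ t ^ 2 + q (X t) = ω₀ ^ 2) (hθ : ∀ t, deriv θ t = -ω₀ + ξ t * deriv X t)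
    (hΓ : ∀ t, (ω₀ : ℂ) * deriv Γ t
      = (((deriv ξ t : ℝ) : ℂ) - Γ t * ((deriv X t : ℝ) : ℂ)) ^ 2 - Γ t ^ 2
        - ((iteratedDeriv 2 q (X t) / 2 : ℝ) : ℂ))
    (ha : ∀ t, 2 * (ω₀ : ℂ) * deriv a t
      = -((((deriv ξ t : ℝ) : ℂ) - Γ t * ((deriv X t : ℝ) : ℂ)) * ((deriv X t : ℝ) : ℂ) + Γ t) * a t)
    (t x : ℝ) :
    iteratedDeriv 2
        (fun τ => (a τ * cexp (I * μ * ((θ τ : ℂ) + (ξ τ : ℂ) * ((x : ℂ) - X τ)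
          + Γ τ / 2 * ((x : ℂ) - X τ) ^ 2))).re) t
      - iteratedDeriv 2
        (fun y : ℝ => (a t * cexp (I * μ * ((θ t : ℂ) + (ξ t : ℂ) * ((y : ℂ) - X t)
          + Γ t / 2 * ((y : ℂ) - X t) ^ 2))).re) x
      + μ ^ 2 * q x * (a t * cexp (I * μ * ((θ t : ℂ) + (ξ t : ℂ) * ((x : ℂ) - X t)
          + Γ t / 2 * ((x : ℂ) - X t) ^ 2))).re
    = (cexp (I * μ * ((θ t : ℂ) + (ξ t : ℂ) * ((x : ℂ) - X t) + Γ t / 2 * ((x : ℂ) - X t) ^ 2))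
      * (μ ^ 2 * a t
          * (-(((deriv ξ t : ℝ) : ℂ) - Γ t * ((deriv X t : ℝ) : ℂ)) * deriv Γ t * ((x : ℂ) - X t) ^ 3
            - deriv Γ t ^ 2 / 4 * ((x : ℂ) - X t) ^ 4
            + ((q x - q (X t) - deriv q (X t) * (x - X t)
                - iteratedDeriv 2 q (X t) / 2 * (x - X t) ^ 2 : ℝ) : ℂ))
        + I * μ * ((2 * (((deriv ξ t : ℝ) : ℂ) - Γ t * ((deriv X t : ℝ) : ℂ)) * deriv a t
              + (((deriv (deriv ξ) t : ℝ) : ℂ) - 2 * deriv Γ t * ((deriv X t : ℝ) : ℂ)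
                - Γ t * ((deriv (deriv X) t : ℝ) : ℂ)) * a t) * ((x : ℂ) - X t)
            + (deriv Γ t * deriv a t + deriv (deriv Γ) t / 2 * a t) * ((x : ℂ) - X t) ^ 2)
        + deriv (deriv a) t)).re := by
  rw [iteratedDeriv_two_re (contDiff_beam_t (μ := μ) hX2 hξ2 hθ2 hΓ2 ha2 x) t,
    iteratedDeriv_two_re (contDiff_beam_x (μ := μ) hX2 hξ2 hθ2 hΓ2 ha2 t) x,
    ← beam_residual hω₀ hX2 hξ2 hθ2 hΓ2 ha2 hX hξ hcons hθ hΓ ha t x, Complex.add_re, Complex.sub_re]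
  congr 1
  have : ((μ : ℂ) ^ 2 * (q x : ℂ)) = ((μ ^ 2 * q x : ℝ) : ℂ) := by push_cast; ring
  rw [this, Complex.re_ofReal_mul]

end RealPart

/-! ### Size of the exponential factor and of the residual -/

section Size

variable {X ξ θ : ℝ → ℝ} {Γ : ℝ → ℂ} {μ : ℝ}

/-- **The Gaussian profile of the beam**: `|exp(iμΦ(t,x))| = exp(−μ · Im Γ(t) · (x − X t)²/2)`
(`θ`, `ξ` real). [cite: Ralston1982, §2] -/
theorem norm_cexp_beamPhase (t x : ℝ) :
    ‖cexp (I * μ * ((θ t : ℂ) + (ξ t : ℂ) * ((x : ℂ) - X t) + Γ t / 2 * ((x : ℂ) - X t) ^ 2))‖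
      = Real.exp (-(μ * (Γ t).im * (x - X t) ^ 2 / 2)) := by
  rw [Complex.norm_exp]
  congr 1
  have hy : ((x : ℂ) - X t) = ((x - X t : ℝ) : ℂ) := by push_cast; ring
  rw [hy]
  simp only [Complex.mul_re, Complex.add_re, Complex.add_im, Complex.mul_im, Complex.I_re,
    Complex.I_im, Complex.ofReal_re, Complex.ofReal_im, Complex.div_ofNat_re, Complex.div_ofNat_im,
    zero_mul, one_mul, zero_sub, sub_zero, mul_zero, add_zero, zero_add]
  rw [show ((x - X t : ℝ) : ℂ) ^ 2 = (((x - X t) ^ 2 : ℝ) : ℂ) by push_cast; ring]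
  simp only [Complex.ofReal_re, Complex.ofReal_im, mul_zero]
  ring

/-- `w e^{−w} ≤ 1` and `w² e^{−w} ≤ 4` for `w ≥ 0`. [folklore] -/
theorem mul_exp_neg_le {w : ℝ} (hw : 0 ≤ w) :
    w * Real.exp (-w) ≤ 1 ∧ w ^ 2 * Real.exp (-w) ≤ 4 := by
  have h1 : w ≤ Real.exp w := by linarith [Real.add_one_le_exp w]
  have h2 : w / 2 ≤ Real.exp (w / 2) := by linarith [Real.add_one_le_exp (w / 2)]
  have hexp : Real.exp (-w) = (Real.exp w)⁻¹ := Real.exp_neg w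
  have hpos : 0 < Real.exp w := Real.exp_pos w
  constructor
  · rw [hexp, mul_inv_le_iff₀ hpos, one_mul]; exact h1
  · rw [hexp, mul_inv_le_iff₀ hpos]
    have h3 : (w / 2) ^ 2 ≤ Real.exp (w / 2) ^ 2 := pow_le_pow_left₀ (by linarith) h2 2
    rw [← Real.exp_nat_mul] at h3
    have : ((2 : ℕ) : ℝ) * (w / 2) = w := by push_cast; ring
    rw [this] at h3
    nlinarith

/-- **Gaussian moment bounds**: for `μ ≥ 1`, `β > 0`, with `E = exp(−μβy²/2)`:
`μy²E ≤ 2/β`, `μ²y⁴E ≤ 16/β²`, `μ|y|E ≤ √μ(2/β + 1)/2`, `μ²|y|³E ≤ √μ(16/β² + 2/β)/2`, `E ≤ 1`.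
[folklore] -/
theorem gaussian_moment_bounds {μ β : ℝ} (hμ : 1 ≤ μ) (hβ : 0 < β) (y : ℝ) :
    μ * y ^ 2 * Real.exp (-(μ * β * y ^ 2 / 2)) ≤ 2 / β ∧
    μ ^ 2 * y ^ 4 * Real.exp (-(μ * β * y ^ 2 / 2)) ≤ 16 / β ^ 2 ∧
    μ * |y| * Real.exp (-(μ * β * y ^ 2 / 2)) ≤ Real.sqrt μ * (2 / β + 1) / 2 ∧
    μ ^ 2 * |y| ^ 3 * Real.exp (-(μ * β * y ^ 2 / 2)) ≤ Real.sqrt μ * (16 / β ^ 2 + 2 / β) / 2 ∧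
    Real.exp (-(μ * β * y ^ 2 / 2)) ≤ 1 := by
  set w : ℝ := μ * β * y ^ 2 / 2 with hw
  have hμ0 : 0 < μ := by linarith
  have hw0 : 0 ≤ w := by positivity
  obtain ⟨e1, e2⟩ := mul_exp_neg_le hw0
  set E : ℝ := Real.exp (-w) with hE
  have hE0 : 0 < E := Real.exp_pos _
  have hE1 : E ≤ 1 := by rw [hE, Real.exp_le_one_iff]; linarith
  -- `μ y² E = (2/β) w E`
  have k2 : μ * y ^ 2 * E ≤ 2 / β := by
    have : μ * y ^ 2 * E = 2 / β * (w * E) := by simp only [hw]; field_simp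
    rw [this]
    calc 2 / β * (w * E) ≤ 2 / β * 1 := by gcongr
      _ = 2 / β := mul_one _
  have k4 : μ ^ 2 * y ^ 4 * E ≤ 16 / β ^ 2 := by
    have : μ ^ 2 * y ^ 4 * E = 4 / β ^ 2 * (w ^ 2 * E) := by simp only [hw]; field_simp; ring
    rw [this]
    calc 4 / β ^ 2 * (w ^ 2 * E) ≤ 4 / β ^ 2 * 4 := by gcongr
      _ = 16 / β ^ 2 := by ring
  -- `2|y| ≤ √μ y² + 1/√μ`
  have hs : 0 < Real.sqrt μ := Real.sqrt_pos.2 hμ0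
  have hsq : Real.sqrt μ ^ 2 = μ := Real.sq_sqrt hμ0.le
  have hamgm : 2 * |y| ≤ Real.sqrt μ * y ^ 2 + 1 / Real.sqrt μ := by
    have h : 0 ≤ (Real.sqrt μ * |y| - 1) ^ 2 := sq_nonneg _
    have hy2 : |y| ^ 2 = y ^ 2 := sq_abs y
    rw [div_eq_mul_inv, one_mul]
    have : Real.sqrt μ * y ^ 2 + (Real.sqrt μ)⁻¹ - 2 * |y|
        = (Real.sqrt μ)⁻¹ * (Real.sqrt μ * |y| - 1) ^ 2 := by
      field_simp
      rw [← hy2]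
      ring
    nlinarith [mul_nonneg (inv_pos.2 hs).le h]
  have k1 : μ * |y| * E ≤ Real.sqrt μ * (2 / β + 1) / 2 := by
    have h := mul_le_mul_of_nonneg_left hamgm (by positivity : 0 ≤ μ * E)
    have e : μ * E * (Real.sqrt μ * y ^ 2 + 1 / Real.sqrt μ)
        = Real.sqrt μ * (μ * y ^ 2 * E + E) := by
      field_simp
      nlinarith [hsq]
    rw [e] at h
    have h' : μ * |y| * E ≤ Real.sqrt μ * (μ * y ^ 2 * E + E) / 2 := by nlinarith
    calc μ * |y| * E ≤ Real.sqrt μ * (μ * y ^ 2 * E + E) / 2 := h'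
      _ ≤ Real.sqrt μ * (2 / β + 1) / 2 := by gcongr
  have k3 : μ ^ 2 * |y| ^ 3 * E ≤ Real.sqrt μ * (16 / β ^ 2 + 2 / β) / 2 := by
    have h := mul_le_mul_of_nonneg_left hamgm (by positivity : 0 ≤ μ ^ 2 * y ^ 2 * E)
    have e : μ ^ 2 * y ^ 2 * E * (Real.sqrt μ * y ^ 2 + 1 / Real.sqrt μ)
        = Real.sqrt μ * (μ ^ 2 * y ^ 4 * E + μ * y ^ 2 * E) := by
      field_simp
      nlinarith [hsq]
    rw [e] at h
    have hy3 : |y| ^ 3 = |y| * y ^ 2 := by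
      rw [pow_succ, sq_abs]; ring
    have h' : μ ^ 2 * |y| ^ 3 * E ≤ Real.sqrt μ * (μ ^ 2 * y ^ 4 * E + μ * y ^ 2 * E) / 2 := by
      rw [hy3]; nlinarith
    calc μ ^ 2 * |y| ^ 3 * E ≤ Real.sqrt μ * (μ ^ 2 * y ^ 4 * E + μ * y ^ 2 * E) / 2 := h'
      _ ≤ Real.sqrt μ * (16 / β ^ 2 + 2 / β) / 2 := by gcongr
  exact ⟨k2, k4, k1, k3, hE1⟩

end Size

end Literature.Analysis.PDE
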